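import Summits.QuantumFields.YangMills.Theorems.FluctuationComparisonRegPrIntLS2BetaComposedDilutionKernel
import Summits.QuantumFields.YangMills.Theorems.FluctuationComparisonRegPrIntLS2BetaTorusCellClasses
import HarnessLib

/-!
# S2β · (K5′, SOURCE-INDEXED EDITION) THE COMPOSED DILUTION KERNEL AS A FAMILY OVER SOURCE LEVELS AT A FIXED TARGET LEVEL: for every target level `n` the kernels `K^{(n←i)} : T^{(n)} × T^{(i)} → ℝ`, `i ≤ n`, with (K0)–(K4′) per pair
# and the EXACT LINEAR PROPAGATION `ρ_n(y) ≤ Σ_z K^{(n←0)} y z·ρ_0 z + Σ_{i=1}^{n} Σ_c K^{(n←i)} y c·src_i c` — no sup, no row-sum carry of the sources (HAZARD «SRC-q», RULING 19:27:44Z)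

Cell `ym3-torus` (YM ladder rung R3 = continuum `SU(2)` Yang–Mills on the three-torus at fixed lattice data — a RUNG: NOT d = 4, NOT infinite volume, NOT a mass gap,
NOT Clay).  Width seat `ym3-torus-px13` (gen 27); crux `stmt-QuantumFields-20520`, LINE g18-1 S2β, pairing lane; (SCT″-c)₁ source budget (S-SRC).  px16 g23's ✓`exists_composedKernel`
(`…S2BetaComposedDilutionKernel`, (K0)–(K5)) carries the sources of the one-step rows by SUP × ROW SUM (`Σ_{i} (L²)^{n−i}·σ_i`); HAZARD «SRC-q» (px13 g27 19:26:24Z, 20520 evidence #58):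
for the quadratic chart remainder this is `N³` off on a single finest bump; ARCHITECT RULING (px17 g22 19:27:44Z): dock every source level like data — which needs the kernels BETWEEN
ALL PAIRS OF LEVELS and the exact propagation identity.  THIS FILE is px16's induction with one more index, indexed by the SOURCE level at a FIXED TARGET level `n` (types `Site P n → Site P i`, one torus, no casts) —
the shape ✓`…SourceDock.dock_of_levelData` consumes (`Kj n := Kf⁽ⁿ⁾ j` chosen per target `n`; no recursion identity across `n` is needed by the dock); px16 g23's sibling
`…ComposedDilutionKernelFamily` (coarse-indexed family `Site P i → Site P 0` with the recursion identity exported + `superposition_le`) is the edition for per-source-level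
shifted tori; both stand.  `--kind proof --supports stmt-QuantumFields-20520 --as helper`, count-neutral,
DEFINITION-FREE; generic `P : Params`, `μ ≠ ν`; `m_P := (d!)²L²∕|I|` (✓`mLL_eq`: `= L²∕L^d`), `cI := |I|`.

WHAT IS PROVED (sorry-free).  ★★★`exists_composedKernelFamily (hμν) : ∀ n ≤ m + K, ∃ Kf : (i : ℕ) → Site P n → Site P i → ℝ` with, for every `i ≤ n`:
(K0) `0 ≤ Kf i y c`; (K1) `Kf i y c ≤ m_P^{n−i}`; (K2) `Σ_y Kf i y c ≤ m_P^{n−i}`; (K3) `Σ_c Kf i y c = (L²)^{n−i}`;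
(K4′) `Kf i y (blockIter i q) ≠ 0 → ∀ κ, |rel y (blockIter n q)|_κ ≤ 2` (support drift ≤ 2, read through finest representatives — ✓`…SourceDock.dock_of_levelData`'s `hK4` VERBATIM);
(K5′) EXACT PROPAGATION: for all `ρ src : (i : ℕ) → Site P i → ℝ` obeying the lower-left rows (px16's text, `i < n`),
  `∀ y, ρ n y ≤ Σ_z Kf 0 y z·ρ 0 z + Σ_{i ∈ Icc 1 n} Σ_c Kf i y c·src i c`.
Construction: `Kf⁽⁰⁾ 0 = δ`; `Kf⁽ⁿ⁺¹⁾ i y c = cI⁻¹·Σ_a Kf⁽ⁿ⁾ i (x_a(y)) c` for `i ≤ n`, `Kf⁽ⁿ⁺¹⁾ i y c = [embIter (n+1) y = embIter i c]` above (`= δ` at `i = n+1`) — the type-uniform diagonal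
through finest representatives (✓`embIter_inj`).  Letters from px16's file by name: `sum_baseLL_le`, `sum_sum_baseLL_le`, `card_triples`, `natAbs_rel_blockOf_le_two_of_baseLL`.

HONEST.  Finite torus combinatorics; nothing of Bałaban's asserted; the source budget itself ((BKG) linear part, (RSP) quadratic part), the dock's use, (★), (SCT″-c)₁₂₃, (LIFT-LAD′), (TOP-LAD′),
(ST″), LOC, GAP♯∘ (`stub_uniformFibreGapOrbit`, registry 3732b7df UNTOUCHED, 0∕5), the five REGISTERED stubs, S2β, crux 20520, 19936, 19200, `YM3TorusSU2` — NOT proved; rung R3 =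
SU(2) YM₃ on T³ — NOT d = 4, NOT infinite volume, NOT a mass gap, NOT Clay; the Yang–Mills mass gap is NOT proved.  Axioms standard.

References: [Balaban1985Averaging] CMP **98** (1985) (19)–(20) p.21, Prop. 1 (51) p.26; [Balaban1987RG1] CMP **109** (1987) (0.1)–(0.4) pp.251–253.
-/

set_option autoImplicit false

noncomputable section

namespace Summit.QuantumFields.YangMills.Theorems.FluctuationComparisonRegPrIntLS2BetaComposedDilutionKernelSourceFamily

open scoped BigOperators
open Finset
open Literature.MathematicalPhysics.QuantumFieldTheory.Balaban1983to89
open Literature.MathematicalPhysics.QuantumFieldTheory.Balaban1983to89.T4Continuum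
open Literature.MathematicalPhysics.QuantumFieldTheory.Balaban1983to89.BlockAveraging (Idx)
open Literature.MathematicalPhysics.QuantumFieldTheory.Balaban1983to89.B10Eq47AxialChi (shiftN shiftN_succ shiftN_zero)
open Literature.MathematicalPhysics.QuantumFieldTheory.Balaban1983to89.B15DeterminingSets (embIter)
open Literature.MathematicalPhysics.QuantumFieldTheory.Balaban1983to89.B15Eq177GaugeInvariance (blockIter_embIter)
open B10Eq27TorusAxialLog (rel rel_apply rel_self)
open B14.Eq22Determines (blockIter blockIter_zero blockIter_succ)
open Summit.QuantumFields.YangMills.Theorems.FluctuationComparisonRegPrIntLS2BetaComposedDilutionKernel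
  (card_triples sum_baseLL_le sum_sum_baseLL_le natAbs_rel_blockOf_le_two_of_baseLL)
open Summit.QuantumFields.YangMills.Theorems.FluctuationComparisonRegPrIntLS2BetaTorusCellClasses (embIter_inj)

variable {P : Params}

/-- ★★★ **THE COMPOSED DILUTION KERNEL AS A FAMILY OVER SOURCE LEVELS, WITH EXACT PROPAGATION** — see the module header for (K0)–(K4′), (K5′).
[cite: Balaban1985Averaging, (19)-(20) p.21, Prop. 1 (51) p.26; Balaban1987RG1, (0.1)-(0.4) pp.251-253] -/
theorem exists_composedKernelFamily {μ ν : Fin P.d} (hμν : μ ≠ ν) : ∀ (n : ℕ), n ≤ P.m + P.K →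
    ∃ Kf : (i : ℕ) → Site P n → Site P i → ℝ,
      (∀ i, i ≤ n → ∀ y c, 0 ≤ Kf i y c) ∧
      (∀ i, i ≤ n → ∀ y c, Kf i y c ≤ ((((Fintype.card (Equiv.Perm (Fin P.d))) ^ 2 * P.L ^ 2 : ℕ) : ℝ) / (Fintype.card (Idx P) : ℝ)) ^ (n - i)) ∧
      (∀ i, i ≤ n → ∀ c, ∑ y, Kf i y c ≤ ((((Fintype.card (Equiv.Perm (Fin P.d))) ^ 2 * P.L ^ 2 : ℕ) : ℝ) / (Fintype.card (Idx P) : ℝ)) ^ (n - i)) ∧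
      (∀ i, i ≤ n → ∀ y, ∑ c, Kf i y c = ((P.L : ℝ) ^ 2) ^ (n - i)) ∧
      (∀ i, i ≤ n → ∀ y (q : Site P 0), Kf i y (blockIter i q) ≠ 0 → ∀ κ, (rel y (blockIter n q) κ).natAbs ≤ 2) ∧
      (∀ (ρ src : (i : ℕ) → Site P i → ℝ),
        (∀ i, i < n → ∀ y' : Site P (i + 1),
            ρ (i + 1) y' ≤ (Fintype.card (Idx P) : ℝ)⁻¹ *
                ∑ a ∈ (Finset.univ : Finset (Idx P)) ×ˢ (Finset.range P.L ×ˢ Finset.range P.L), ρ i (shiftN (shiftN (Site.blockSite y' a.1.1) μ a.2.1) ν a.2.2) +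
              src (i + 1) y') →
        ∀ y : Site P n, ρ n y ≤ ∑ z, Kf 0 y z * ρ 0 z + ∑ i ∈ Finset.Icc 1 n, ∑ c, Kf i y c * src i c)
  | 0, _ => by
      classical
      refine ⟨fun i y c => if embIter 0 y = embIter i c then 1 else 0, ?_, ?_, ?_, ?_, ?_, ?_⟩
      · intro i _ y c; dsimp only; split_ifs <;> norm_num
      · intro i hi y c
        obtain rfl : i = 0 := Nat.le_zero.mp hi
        dsimp only; rw [Nat.sub_zero, pow_zero]; split_ifs <;> norm_num
      · intro i hi c
        obtain rfl : i = 0 := Nat.le_zero.mp hi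
        show ∑ y : Site P 0, (if y = c then (1 : ℝ) else 0) ≤ _
        rw [Nat.sub_zero, pow_zero, Finset.sum_ite_eq', if_pos (Finset.mem_univ _)]
      · intro i hi y
        obtain rfl : i = 0 := Nat.le_zero.mp hi
        show ∑ c : Site P 0, (if y = c then (1 : ℝ) else 0) = _
        rw [Nat.sub_zero, pow_zero, Finset.sum_ite_eq, if_pos (Finset.mem_univ _)]
      · intro i hi y q h κ
        obtain rfl : i = 0 := Nat.le_zero.mp hi
        have hyq : y = q := by
          by_contra hne; exact h (if_neg (by simpa [embIter] using hne))
        subst hyq; rw [blockIter_zero, rel_self]; simp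
      · intro ρ src _ y
        have h1 : ∑ z : Site P 0, (if embIter 0 y = embIter 0 z then (1 : ℝ) else 0) * ρ 0 z = ρ 0 y := by
          show ∑ z : Site P 0, (if y = z then (1 : ℝ) else 0) * ρ 0 z = ρ 0 y
          simp only [ite_mul, one_mul, zero_mul, Finset.sum_ite_eq, Finset.mem_univ, if_true]
        rw [h1, Finset.Icc_eq_empty_of_lt Nat.zero_lt_one, Finset.sum_empty, add_zero]
  | n + 1, hn => by
      classical
      obtain ⟨Kf', h0, h1, h2, h3, h4, h5⟩ := exists_composedKernelFamily hμν n (Nat.le_of_succ_le hn)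
      -- abbreviations (px16's)
      set A : Finset (Idx P × (ℕ × ℕ)) := (Finset.univ : Finset (Idx P)) ×ˢ (Finset.range P.L ×ˢ Finset.range P.L) with hA
      set cI : ℝ := (Fintype.card (Idx P) : ℝ) with hcI
      set C : ℝ := ((((Fintype.card (Equiv.Perm (Fin P.d))) ^ 2 * P.L ^ 2 : ℕ) : ℝ)) with hC
      set mP : ℝ := C / cI with hmP
      have hcIpos : 0 < cI := by rw [hcI]; exact_mod_cast Fintype.card_pos
      have hC0 : 0 ≤ C := by rw [hC]; exact Nat.cast_nonneg _
      have hmPC : mP = cI⁻¹ * C := by rw [hmP, div_eq_inv_mul]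
      have hmP0 : 0 ≤ mP := by rw [hmP]; exact div_nonneg hC0 hcIpos.le
      have hmem : ∀ a ∈ A, a.2.1 < P.L ∧ a.2.2 < P.L := fun a ha => by
        rw [hA, Finset.mem_product, Finset.mem_product, Finset.mem_range, Finset.mem_range] at ha; exact ha.2
      have hcardA : (A.card : ℝ) = cI * (P.L : ℝ) ^ 2 := by rw [hA, card_triples, hcI]; push_cast; ring
      have hinj : Function.Injective (embIter (P := P) (n + 1)) := fun a b h => embIter_inj hn h
      -- the new family: average below the new top, diagonal at the new top
      refine ⟨fun i y c => if i ≤ n then cI⁻¹ * ∑ a ∈ A, Kf' i (shiftN (shiftN (Site.blockSite y a.1.1) μ a.2.1) ν a.2.2) c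
          else (if embIter (n + 1) y = embIter i c then 1 else 0), ?_, ?_, ?_, ?_, ?_, ?_⟩
      · -- (K0)
        intro i _ y c
        dsimp only
        split_ifs with hi
        · exact mul_nonneg (inv_nonneg.mpr hcIpos.le) (Finset.sum_nonneg fun a _ => h0 i hi _ _)
        · norm_num
        · norm_num
      · -- (K1)
        intro i hi y c
        dsimp only
        by_cases hin : i ≤ n
        · rw [if_pos hin]
          have hfib := sum_baseLL_le hn y μ ν (fun y' => Kf' i y' c) (fun y' => h0 i hin y' c)
          have hsub : n + 1 - i = (n - i) + 1 := by omega
          calc cI⁻¹ * ∑ a ∈ A, Kf' i (shiftN (shiftN (Site.blockSite y a.1.1) μ a.2.1) ν a.2.2) c ≤ cI⁻¹ * (C * ∑ y', Kf' i y' c) :=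
                mul_le_mul_of_nonneg_left hfib (inv_nonneg.mpr hcIpos.le)
            _ = mP * ∑ y', Kf' i y' c := by rw [hmPC]; ring
            _ ≤ mP * mP ^ (n - i) := mul_le_mul_of_nonneg_left (h2 i hin c) hmP0
            _ = mP ^ (n + 1 - i) := by rw [hsub, pow_succ]; ring
        · have hi' : i = n + 1 := by omega
          subst hi'
          rw [if_neg hin, Nat.sub_self, pow_zero]
          split_ifs <;> norm_num
      · -- (K2)
        intro i hi c
        dsimp only
        by_cases hin : i ≤ n
        · simp only [if_pos hin]
          have hjoint := sum_sum_baseLL_le hn μ ν (fun y' => Kf' i y' c) (fun y' => h0 i hin y' c)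
          have hsub : n + 1 - i = (n - i) + 1 := by omega
          calc ∑ y, cI⁻¹ * ∑ a ∈ A, Kf' i (shiftN (shiftN (Site.blockSite y a.1.1) μ a.2.1) ν a.2.2) c
              = cI⁻¹ * ∑ y, ∑ a ∈ A, Kf' i (shiftN (shiftN (Site.blockSite y a.1.1) μ a.2.1) ν a.2.2) c := by rw [Finset.mul_sum]
            _ ≤ cI⁻¹ * (C * ∑ y', Kf' i y' c) := mul_le_mul_of_nonneg_left hjoint (inv_nonneg.mpr hcIpos.le)
            _ = mP * ∑ y', Kf' i y' c := by rw [hmPC]; ring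
            _ ≤ mP * mP ^ (n - i) := mul_le_mul_of_nonneg_left (h2 i hin c) hmP0
            _ = mP ^ (n + 1 - i) := by rw [hsub, pow_succ]; ring
        · have hi' : i = n + 1 := by omega
          subst hi'
          simp only [if_neg hin, Nat.sub_self, pow_zero, hinj.eq_iff]
          rw [Finset.sum_ite_eq', if_pos (Finset.mem_univ _)]
      · -- (K3)
        intro i hi y
        dsimp only
        by_cases hin : i ≤ n
        · simp only [if_pos hin]
          have hsub : n + 1 - i = (n - i) + 1 := by omega
          rw [← Finset.mul_sum, Finset.sum_comm]
          calc cI⁻¹ * ∑ a ∈ A, ∑ c, Kf' i (shiftN (shiftN (Site.blockSite y a.1.1) μ a.2.1) ν a.2.2) c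
              = cI⁻¹ * ∑ a ∈ A, ((P.L : ℝ) ^ 2) ^ (n - i) := by
                congr 1; exact Finset.sum_congr rfl fun a _ => h3 i hin _
            _ = cI⁻¹ * (A.card * ((P.L : ℝ) ^ 2) ^ (n - i)) := by rw [Finset.sum_const, nsmul_eq_mul]
            _ = ((P.L : ℝ) ^ 2) ^ (n + 1 - i) := by
                rw [hcardA, hsub]; field_simp; ring
        · have hi' : i = n + 1 := by omega
          subst hi'
          simp only [if_neg hin, Nat.sub_self, pow_zero, hinj.eq_iff]
          rw [Finset.sum_ite_eq, if_pos (Finset.mem_univ _)]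
      · -- (K4′)
        intro i hi y q h κ
        dsimp only at h
        by_cases hin : i ≤ n
        · rw [if_pos hin] at h
          have hne : ∑ a ∈ A, Kf' i (shiftN (shiftN (Site.blockSite y a.1.1) μ a.2.1) ν a.2.2) (blockIter i q) ≠ 0 := by
            intro h0'; exact h (by rw [h0', mul_zero])
          obtain ⟨a, ha, hKa⟩ := Finset.exists_ne_zero_of_sum_ne_zero hne
          have hst := hmem a ha
          have hw := h4 i hin _ q hKa
          rw [blockIter_succ]
          exact natAbs_rel_blockOf_le_two_of_baseLL hn y hμν a.1.1 hst.1 hst.2 (blockIter n q) hw κ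
        · have hi' : i = n + 1 := by omega
          subst hi'
          rw [if_neg hin] at h
          have hyq : embIter (n + 1) y = embIter (n + 1) (blockIter (n + 1) q) := by
            by_contra hne; exact h (if_neg hne)
          rw [← hinj hyq, rel_self]; simp
      · -- (K5′)
        intro ρ src hrow y
        -- the inductive propagation at every base point of `y`
        have hIH : ∀ a ∈ A, ρ n (shiftN (shiftN (Site.blockSite y a.1.1) μ a.2.1) ν a.2.2) ≤
            ∑ z, Kf' 0 (shiftN (shiftN (Site.blockSite y a.1.1) μ a.2.1) ν a.2.2) z * ρ 0 z +
              ∑ i ∈ Finset.Icc 1 n, ∑ c, Kf' i (shiftN (shiftN (Site.blockSite y a.1.1) μ a.2.1) ν a.2.2) c * src i c :=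
          fun a _ => h5 ρ src (fun i hi y' => hrow i (by omega) y') _
        -- average them
        have havg : cI⁻¹ * ∑ a ∈ A, ρ n (shiftN (shiftN (Site.blockSite y a.1.1) μ a.2.1) ν a.2.2) ≤
            ∑ z, (cI⁻¹ * ∑ a ∈ A, Kf' 0 (shiftN (shiftN (Site.blockSite y a.1.1) μ a.2.1) ν a.2.2) z) * ρ 0 z +
              ∑ i ∈ Finset.Icc 1 n, ∑ c, (cI⁻¹ * ∑ a ∈ A, Kf' i (shiftN (shiftN (Site.blockSite y a.1.1) μ a.2.1) ν a.2.2) c) * src i c := by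
          have step1 := mul_le_mul_of_nonneg_left (Finset.sum_le_sum hIH) (inv_nonneg.mpr hcIpos.le)
          refine step1.trans (le_of_eq ?_)
          rw [Finset.sum_add_distrib, mul_add]
          congr 1
          · rw [Finset.sum_comm, Finset.mul_sum]
            refine Finset.sum_congr rfl fun z _ => ?_
            rw [← Finset.sum_mul, mul_assoc]
          · rw [Finset.sum_comm, Finset.mul_sum]
            refine Finset.sum_congr rfl fun i _ => ?_
            rw [Finset.sum_comm, Finset.mul_sum]
            refine Finset.sum_congr rfl fun c _ => ?_
            rw [← Finset.sum_mul, mul_assoc]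
        -- the new family read at `i ≤ n` and at the new top
        have hK0eq : ∀ z, (if (0 : ℕ) ≤ n then cI⁻¹ * ∑ a ∈ A, Kf' 0 (shiftN (shiftN (Site.blockSite y a.1.1) μ a.2.1) ν a.2.2) z
            else (if embIter (n + 1) y = embIter 0 z then 1 else 0)) =
            cI⁻¹ * ∑ a ∈ A, Kf' 0 (shiftN (shiftN (Site.blockSite y a.1.1) μ a.2.1) ν a.2.2) z := fun z => if_pos (Nat.zero_le n)
        have hKieq : ∀ i ∈ Finset.Icc 1 n, ∀ c, (if i ≤ n then cI⁻¹ * ∑ a ∈ A, Kf' i (shiftN (shiftN (Site.blockSite y a.1.1) μ a.2.1) ν a.2.2) c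
            else (if embIter (n + 1) y = embIter i c then 1 else 0)) =
            cI⁻¹ * ∑ a ∈ A, Kf' i (shiftN (shiftN (Site.blockSite y a.1.1) μ a.2.1) ν a.2.2) c := by
          intro i hi c; rw [Finset.mem_Icc] at hi; exact if_pos hi.2
        have htop : ∑ c : Site P (n + 1), (if n + 1 ≤ n then cI⁻¹ * ∑ a ∈ A, Kf' (n + 1) (shiftN (shiftN (Site.blockSite y a.1.1) μ a.2.1) ν a.2.2) c
            else (if embIter (n + 1) y = embIter (n + 1) c then 1 else 0)) * src (n + 1) c = src (n + 1) y := by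
          simp only [if_neg (Nat.not_succ_le_self n), hinj.eq_iff, ite_mul, one_mul, zero_mul, Finset.sum_ite_eq, Finset.mem_univ, if_true]
        -- assemble
        have hrow' := hrow n (Nat.lt_succ_self n) y
        rw [Finset.sum_Icc_succ_top (by omega : 1 ≤ n + 1), htop]
        simp only [hK0eq]
        rw [Finset.sum_congr rfl fun i hi => Finset.sum_congr rfl fun c _ => by rw [hKieq i hi c]]
        calc ρ (n + 1) y ≤ cI⁻¹ * ∑ a ∈ A, ρ n (shiftN (shiftN (Site.blockSite y a.1.1) μ a.2.1) ν a.2.2) + src (n + 1) y := hrow'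
          _ ≤ _ := by linarith [havg]

end Summit.QuantumFields.YangMills.Theorems.FluctuationComparisonRegPrIntLS2BetaComposedDilutionKernelSourceFamily

end
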